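import Summits.CriticalPhenomena.PercolationContinuityZ3.Theorems.PercNearOneGluingNoHeavyQuantThreeClusterCountReduction
import HarnessLib

/-!
# The rooted fibre map ("door at a ball around `a`"): it lands in `ab|c` and is decodable given the root region

builds on p205010 (kernel theorem, internal audit signed; external expert review pending)

Support file (`--supports stmt-CriticalPhenomena-4575`), seat `prim-quant-p1` (gen 43); memo
`run/shared/lean/prim/quant/prim-quant-p1-g43/FOR-LEAD-Z32-FIBRES.md` §2.  No definitions, no named facts, no sorries;
standard axioms.  Purely combinatorial (arbitrary edge sets on an arbitrary vertex type); no measure, no counting.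

CONTEXT.  The three-port case of `Z(3,2)` is reduced (✓ p583525, ✓ p613921) to the per-class count
`TN ≤ 3·E` (`TN` = `{C₁ ∈ abc, C₂ ∈ a|b|c}`, `E` = `{C₁ ∈ ab|c ∪ ac|b}`, `C₂` the complement of `C₁` on the free edges);
the kernel has `TN ≤ 2·E + #R₀` (seals + cut-offs).  Every remaining scheme of the p1 line (memo of p1 g42 §7–§8: Hall for
the "multi-depth fibre system"; this seat's memo §1: its census through 12 vertices) uses ONE further two-configuration map,
the ROOTED FIBRE MAP, whose combinatorial heart is proved here once and for all, for an ARBITRARY root region: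

* Data: a vertex set `A` (think: the `C₁`-ball of radius `d-1` round `a`; `A = ∅` is the depth-0 case), its closed
  `C₁`-neighbourhood `N = {a} ∪ A ∪ N_{C₁}(A)`, the `C₂`-cluster `S` of `b`, the edges `TA` touching `A`, the DOOR SET
  `J` = the `C₁`-open edges from `N` into `S`, the swap region `W = TA ∪ J`, and the mixture `Z := C₁ on W, C₂ elsewhere`.
* `fibre_reachable_b`, `fibre_not_reachable_c`: if `A` is `C₁`-reachable from `a` inside `TA`, `N` misses the `C₂`-clusters of
  `b` and of `c`, `b ↮ c` in `C₂`, and `J ≠ ∅`, then `Z ∈ ab|c`.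
* `fibre_decode_N`, `fibre_decode_S`, `fibre_decode_J`: `N`, `S` and `J` (hence `W`, hence `C₁` and `C₂` on every edge) are
  read off `Z` GIVEN `A` — the map is injective on every family of pairs sharing the root region.
* The counting forms (`classCount_fibre_le`, and the depth-0 count `TN₀ ≤ E` per class) are in the companion file
  `…QuantThreeClusterFibreCount`.
For the fibre of depth `d ≥ 1` one takes `A` = the `C₁`-ball of radius `d-1`; the partner sets of one depth are then disjoint
(the ball is read off `Z`), and two fibres of different depths share at most one partner (memo §2).
-/

namespace Summit.CriticalPhenomena.PercolationContinuityZ3.Theorems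

open Finset Literature.Probability.Percolation Literature.Probability.Percolation.DecisionTree

variable {V : Type*}

namespace ThreeClusterSwap

section Fibre

variable (C₁ C₂ : Set (Sym2 V)) (a b c : V) (A N S : Set V) (TA J W Z : Set (Sym2 V))

/-- An edge of the swap region `W = TA ∪ J` carries its `C₁`-value in `Z`; an edge off `W` its `C₂`-value. [this work] -/
theorem fibre_mem_Z_iff_of_mem_W (hZ : Z = (C₁ ∩ W) ∪ (C₂ \ W)) {e : Sym2 V} (he : e ∈ W) :
    e ∈ Z ↔ e ∈ C₁ := by
  rw [hZ]
  constructor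
  · rintro (⟨h1, -⟩ | ⟨-, hnW⟩)
    · exact h1
    · exact (hnW he).elim
  · intro h1; exact Or.inl ⟨h1, he⟩

/-- Companion of `fibre_mem_Z_iff_of_mem_W` off the region. [this work] -/
theorem fibre_mem_Z_iff_of_not_mem_W (hZ : Z = (C₁ ∩ W) ∪ (C₂ \ W)) {e : Sym2 V} (he : e ∉ W) :
    e ∈ Z ↔ e ∈ C₂ := by
  rw [hZ]
  constructor
  · rintro (⟨-, hW⟩ | ⟨h2, -⟩)
    · exact (he hW).elim
    · exact h2
  · intro h2; exact Or.inr ⟨h2, he⟩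

/-- **Rooted fibre, inside.**  If every vertex of the root region `A` is `C₁`-reachable from `a` through edges touching `A`,
then every vertex of `N = {a} ∪ A ∪ N_{C₁}(A)` is `Z`-reachable from `a`. [this work] -/
theorem fibre_reachable_of_mem_N
    (hN : N = {v | v = a ∨ v ∈ A ∨ ∃ u ∈ A, s(u, v) ∈ C₁ ∧ u ≠ v}) (hTA : TA = {e | ∃ v ∈ A, v ∈ e})
    (hW : W = TA ∪ J) (hZ : Z = (C₁ ∩ W) ∪ (C₂ \ W))
    (hconn : ∀ v ∈ A, (openGraph (C₁ ∩ TA)).Reachable a v) {v : V} (hv : v ∈ N) :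
    (openGraph Z).Reachable a v := by
  have hsub : C₁ ∩ TA ⊆ Z := by
    intro e he
    rw [hZ]; exact Or.inl ⟨he.1, by rw [hW]; exact Or.inl he.2⟩
  -- monotonicity `C₁ ∩ TA ⊆ Z` of reachability (cf. `UncenteredTransfer.reach_mono`; inlined to keep the imports minimal)
  have hmono : ∀ w, (openGraph (C₁ ∩ TA)).Reachable a w → (openGraph Z).Reachable a w := fun w hw =>
    (reachable_transfer (G' := openGraph Z) (P := fun _ => True) hw trivial (fun x y _ hxy => by
      rw [openGraph_adj] at hxy ⊢
      exact ⟨trivial, hsub hxy.1, hxy.2⟩)).1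
  rw [hN] at hv
  rcases hv with rfl | hvA | ⟨u, huA, huv, hne⟩
  · exact SimpleGraph.Reachable.refl _
  · exact hmono v (hconn v hvA)
  · have hu : (openGraph Z).Reachable a u := hmono u (hconn u huA)
    have he : s(u, v) ∈ Z := hsub ⟨huv, by rw [hTA]; exact ⟨u, huA, Sym2.mem_mk_left u v⟩⟩
    exact hu.trans ((openGraph_adj Z u v).2 ⟨he, hne⟩).reachable

/-- An edge with both endpoints in the `C₂`-cluster `S` of `b` lies outside the swap region, provided `N` misses `S`. [this work] -/
theorem fibre_not_mem_W_of_mem_S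
    (hN : N = {v | v = a ∨ v ∈ A ∨ ∃ u ∈ A, s(u, v) ∈ C₁ ∧ u ≠ v}) (hTA : TA = {e | ∃ v ∈ A, v ∈ e})
    (hJ : J = {e | e ∈ C₁ ∧ ∃ u ∈ N, ∃ s ∈ S, e = s(u, s)}) (hW : W = TA ∪ J)
    (hNS : ∀ v ∈ N, v ∉ S) {x w : V} (hx : x ∈ S) (hw : w ∈ S) : s(x, w) ∉ W := by
  have hAN : ∀ v ∈ A, v ∈ N := fun v hv => by rw [hN]; exact Or.inr (Or.inl hv)
  rw [hW]
  rintro (hT | hJ')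
  · rw [hTA] at hT
    obtain ⟨v, hvA, hv⟩ := hT
    rcases Sym2.mem_iff.1 hv with rfl | rfl
    · exact hNS v (hAN v hvA) hx
    · exact hNS v (hAN v hvA) hw
  · rw [hJ] at hJ'
    obtain ⟨-, u, huN, s, -, he⟩ := hJ'
    have hu : u ∈ s(x, w) := by rw [he]; exact Sym2.mem_mk_left u s
    rcases Sym2.mem_iff.1 hu with rfl | rfl
    · exact hNS u huN hx
    · exact hNS u huN hw

/-- **Rooted fibre lands in `ab|c`, part 1: `a ↔ b` in `Z`.**  Hypotheses: `A` reachable from `a` inside `TA`, `N` misses the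
`C₂`-cluster `S` of `b`, and the door set `J` is non-empty. [this work] -/
theorem fibre_reachable_b
    (hN : N = {v | v = a ∨ v ∈ A ∨ ∃ u ∈ A, s(u, v) ∈ C₁ ∧ u ≠ v}) (hS : S = {v | (openGraph C₂).Reachable b v})
    (hTA : TA = {e | ∃ v ∈ A, v ∈ e}) (hJ : J = {e | e ∈ C₁ ∧ ∃ u ∈ N, ∃ s ∈ S, e = s(u, s)})
    (hW : W = TA ∪ J) (hZ : Z = (C₁ ∩ W) ∪ (C₂ \ W))
    (hconn : ∀ v ∈ A, (openGraph (C₁ ∩ TA)).Reachable a v) (hNS : ∀ v ∈ N, v ∉ S) (hJne : ∃ e, e ∈ J) :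
    (openGraph Z).Reachable a b := by
  obtain ⟨e, he⟩ := hJne
  have he' := he
  rw [hJ] at he'
  obtain ⟨he1, u, huN, s, hsS, rfl⟩ := he'
  -- reach the door's inner end, cross the door
  have hu : (openGraph Z).Reachable a u := fibre_reachable_of_mem_N C₁ C₂ a A N TA J W Z hN hTA hW hZ hconn huN
  have hus : u ≠ s := fun h => hNS u huN (h ▸ hsS)
  have hdoor : s(u, s) ∈ Z := by
    rw [hZ]; exact Or.inl ⟨he1, by rw [hW]; exact Or.inr he⟩
  have has : (openGraph Z).Reachable a s := hu.trans ((openGraph_adj Z u s).2 ⟨hdoor, hus⟩).reachable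
  -- then follow the `C₂`-cluster of `b` (whose edges lie off `W`) down to `b`
  have hbs : (openGraph C₂).Reachable b s := by rw [hS] at hsS; exact hsS
  have hbS : b ∈ S := by rw [hS]; exact SimpleGraph.Reachable.refl b
  have key := reachable_transfer (G' := openGraph Z) (P := fun x => x ∈ S) hbs hbS (by
    intro x w hx hxw
    rw [openGraph_adj] at hxw
    have hw : w ∈ S := by
      rw [hS] at hx ⊢
      exact hx.trans ((openGraph_adj C₂ x w).2 hxw).reachable
    have hnW : s(x, w) ∉ W := fibre_not_mem_W_of_mem_S C₁ a A N S TA J W hN hTA hJ hW hNS hx hw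
    refine ⟨hw, (openGraph_adj Z x w).2 ⟨?_, hxw.2⟩⟩
    rw [hZ]; exact Or.inr ⟨hxw.1, hnW⟩)
  exact has.trans key.1.symm

/-- **Rooted fibre lands in `ab|c`, part 2: `a ↮ c` in `Z`.**  Hypotheses: `N` misses the `C₂`-cluster of `c`, `b ↮ c` in `C₂`
(so a door never ends in that cluster). [this work] -/
theorem fibre_not_reachable_c
    (hN : N = {v | v = a ∨ v ∈ A ∨ ∃ u ∈ A, s(u, v) ∈ C₁ ∧ u ≠ v}) (hS : S = {v | (openGraph C₂).Reachable b v})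
    (hTA : TA = {e | ∃ v ∈ A, v ∈ e}) (hJ : J = {e | e ∈ C₁ ∧ ∃ u ∈ N, ∃ s ∈ S, e = s(u, s)})
    (hW : W = TA ∪ J) (hZ : Z = (C₁ ∩ W) ∪ (C₂ \ W))
    (hNSc : ∀ v ∈ N, ¬ (openGraph C₂).Reachable c v) (hbc : ¬ (openGraph C₂).Reachable b c) :
    ¬ (openGraph Z).Reachable a c := by
  have haN : a ∈ N := by rw [hN]; exact Or.inl rfl
  have hAN : ∀ v ∈ A, v ∈ N := fun v hv => by rw [hN]; exact Or.inr (Or.inl hv)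
  intro hac
  have key := reachable_invariant (P := fun x => ¬ (openGraph C₂).Reachable c x) hac (hNSc a haN) (by
    intro x w hx hxw hcw
    rw [openGraph_adj] at hxw
    obtain ⟨hxwZ, hne⟩ := hxw
    rw [hZ] at hxwZ
    rcases hxwZ with ⟨h1, hWm⟩ | ⟨h2, -⟩
    · rw [hW] at hWm
      rcases hWm with hT | hJ'
      · rw [hTA] at hT
        obtain ⟨v, hvA, hv⟩ := hT
        rcases Sym2.mem_iff.1 hv with rfl | rfl
        · -- `x ∈ A`, so `w` is a `C₁`-neighbour of `A`, i.e. in `N`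
          have hwN : w ∈ N := by rw [hN]; exact Or.inr (Or.inr ⟨v, hvA, h1, hne⟩)
          exact hNSc w hwN hcw
        · exact hNSc v (hAN v hvA) hcw
      · rw [hJ] at hJ'
        obtain ⟨-, u, huN, s, hsS, he⟩ := hJ'
        rcases Sym2.eq_iff.1 he with ⟨-, hws⟩ | ⟨-, hwu⟩
        · -- `w = s ∈ S`: then `b ↔ w ↔ c` in `C₂`
          rw [hS] at hsS
          rw [hws] at hcw
          exact hbc (hsS.trans hcw.symm)
        · rw [hwu] at hcw
          exact hNSc u huN hcw
    · -- off the region the edge is `C₂`-open, so `x` would be in the `C₂`-cluster of `c`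
      exact hx (hcw.trans ((openGraph_adj C₂ w x).2 ⟨by rw [Sym2.eq_swap]; exact h2, hne.symm⟩).reachable))
  exact key (SimpleGraph.Reachable.refl c)

/-- **Decoding, 1: the neighbourhood.**  `N` is read off `Z` (given `A`): the edges at `A` carry their `C₁`-values. [this work] -/
theorem fibre_decode_N
    (hN : N = {v | v = a ∨ v ∈ A ∨ ∃ u ∈ A, s(u, v) ∈ C₁ ∧ u ≠ v}) (hTA : TA = {e | ∃ v ∈ A, v ∈ e})
    (hW : W = TA ∪ J) (hZ : Z = (C₁ ∩ W) ∪ (C₂ \ W)) :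
    {v | v = a ∨ v ∈ A ∨ ∃ u ∈ A, s(u, v) ∈ Z ∧ u ≠ v} = N := by
  have hAZ : ∀ u ∈ A, ∀ v, (s(u, v) ∈ Z ↔ s(u, v) ∈ C₁) := fun u hu v =>
    fibre_mem_Z_iff_of_mem_W C₁ C₂ W Z hZ (by rw [hW, hTA]; exact Or.inl ⟨u, hu, Sym2.mem_mk_left u v⟩)
  rw [hN]
  ext v
  simp only [Set.mem_setOf_eq]
  constructor
  · rintro (h | h | ⟨u, hu, huv, hne⟩)
    · exact Or.inl h
    · exact Or.inr (Or.inl h)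
    · exact Or.inr (Or.inr ⟨u, hu, (hAZ u hu v).1 huv, hne⟩)
  · rintro (h | h | ⟨u, hu, huv, hne⟩)
    · exact Or.inl h
    · exact Or.inr (Or.inl h)
    · exact Or.inr (Or.inr ⟨u, hu, (hAZ u hu v).2 huv, hne⟩)

/-- **Decoding, 2: the cluster of `b`.**  With `TN` the edges touching `N`: the `b`-cluster of `Z ∖ TN` is exactly `S = C_b(C₂)`
(the region `W` lies inside `TN`, and `S` misses `N`). [this work] -/
theorem fibre_decode_S
    (hN : N = {v | v = a ∨ v ∈ A ∨ ∃ u ∈ A, s(u, v) ∈ C₁ ∧ u ≠ v}) (hS : S = {v | (openGraph C₂).Reachable b v})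
    (hTA : TA = {e | ∃ v ∈ A, v ∈ e}) (hJ : J = {e | e ∈ C₁ ∧ ∃ u ∈ N, ∃ s ∈ S, e = s(u, s)})
    (hW : W = TA ∪ J) (hZ : Z = (C₁ ∩ W) ∪ (C₂ \ W)) (hNS : ∀ v ∈ N, v ∉ S) (v : V) :
    (openGraph (Z \ {e | ∃ u ∈ N, u ∈ e})).Reachable b v ↔ (openGraph C₂).Reachable b v := by
  have hAN : ∀ v ∈ A, v ∈ N := fun v hv => by rw [hN]; exact Or.inr (Or.inl hv)
  -- `W ⊆ TN`
  have hWTN : ∀ e ∈ W, e ∈ {e : Sym2 V | ∃ u ∈ N, u ∈ e} := by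
    intro e he
    rw [hW] at he
    rcases he with hT | hJ'
    · rw [hTA] at hT
      obtain ⟨v, hvA, hv⟩ := hT
      exact ⟨v, hAN v hvA, hv⟩
    · rw [hJ] at hJ'
      obtain ⟨-, u, huN, s, -, rfl⟩ := hJ'
      exact ⟨u, huN, Sym2.mem_mk_left u s⟩
  constructor
  · intro h
    refine (reachable_transfer (G' := openGraph C₂) (P := fun _ => True) h trivial fun x y _ hxy => ?_).1
    rw [openGraph_adj] at hxy ⊢
    obtain ⟨⟨heZ, hnTN⟩, hne⟩ := hxy
    have hnW : s(x, y) ∉ W := fun hW' => hnTN (hWTN _ hW')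
    exact ⟨trivial, (fibre_mem_Z_iff_of_not_mem_W C₁ C₂ W Z hZ hnW).1 heZ, hne⟩
  · intro h
    have hbS : b ∈ S := by rw [hS]; exact SimpleGraph.Reachable.refl b
    have key := reachable_transfer (G' := openGraph (Z \ {e | ∃ u ∈ N, u ∈ e})) (P := fun x => x ∈ S) h hbS (by
      intro x w hx hxw
      rw [openGraph_adj] at hxw
      have hw : w ∈ S := by
        rw [hS] at hx ⊢
        exact hx.trans ((openGraph_adj C₂ x w).2 hxw).reachable
      have hnW : s(x, w) ∉ W := fibre_not_mem_W_of_mem_S C₁ a A N S TA J W hN hTA hJ hW hNS hx hw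
      refine ⟨hw, (openGraph_adj _ x w).2 ⟨⟨?_, ?_⟩, hxw.2⟩⟩
      · rw [hZ]; exact Or.inr ⟨hxw.1, hnW⟩
      · rintro ⟨u, huN, hu⟩
        rcases Sym2.mem_iff.1 hu with rfl | rfl
        · exact hNS u huN hx
        · exact hNS u huN hw)
    exact key.1

/-- **Decoding, 3: the door set.**  `J` is read off `Z`, `N` and `S`: the doors are exactly the `Z`-open edges from `N` to `S`
(an edge from `N` to `S` off the region would be `C₂`-open and put its `N`-end into `S`). [this work] -/
theorem fibre_decode_J
    (hS : S = {v | (openGraph C₂).Reachable b v})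
    (hJ : J = {e | e ∈ C₁ ∧ ∃ u ∈ N, ∃ s ∈ S, e = s(u, s)})
    (hW : W = TA ∪ J) (hZ : Z = (C₁ ∩ W) ∪ (C₂ \ W)) (hNS : ∀ v ∈ N, v ∉ S) :
    {e | e ∈ Z ∧ ∃ u ∈ N, ∃ s ∈ S, e = s(u, s)} = J := by
  ext e
  constructor
  · rintro ⟨heZ, u, huN, s, hsS, rfl⟩
    rw [hJ]
    refine ⟨?_, u, huN, s, hsS, rfl⟩
    rw [hZ] at heZ
    rcases heZ with ⟨h1, -⟩ | ⟨h2, -⟩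
    · exact h1
    · -- a `C₂`-open edge from `u` into `S` puts `u` into `S`
      exfalso
      by_cases hus : u = s
      · exact hNS u huN (hus ▸ hsS)
      · apply hNS u huN
        rw [hS] at hsS ⊢
        exact hsS.trans ((openGraph_adj C₂ s u).2 ⟨by rw [Sym2.eq_swap]; exact h2, fun h => hus h.symm⟩).reachable
  · intro he
    have he' := he
    rw [hJ] at he'
    obtain ⟨he1, u, huN, s, hsS, rfl⟩ := he'
    refine ⟨?_, u, huN, s, hsS, rfl⟩
    rw [hZ]; exact Or.inl ⟨he1, by rw [hW]; exact Or.inr he⟩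

end Fibre

end ThreeClusterSwap

end Summit.CriticalPhenomena.PercolationContinuityZ3.Theorems
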